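/-
Copyright: statement-level skeleton of a published paper (lit-balaban cell, Phase-2 proof seat p10, gen 4). No proof claims
beyond what the kernel checks below.
-/
import Mathlib
import Literature.MathematicalPhysics.QuantumFieldTheory.BalabanImbrieJaffe1984to88.BIJ85Thm711ClosedCube

/-!
# `BalabanImbrieJaffe1984to88.BIJ85Eq7113Derivation` — T. Bałaban, J. Imbrie, A. Jaffe, *Renormalization of the Higgs model:
minimizers, propagators and the stability of mean field theory*, Commun. Math. Phys. **97** (1985) 299–329
[BalabanImbrieJaffe1985]: Sect. 7.1 p. 322 — **the derivation (7.1.12) ⟹ (7.1.13)–(7.1.16) at a fixed fibre p′**: the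
«straightforward, algebraic manipulation» that turns σ_k = Q^e_k(I − ∂G_{k,Ax}∂^*)Q^{e*}_k into τ₁ + τ₂, PROVED as an identity of
quadratic forms on two-forms, with r15's typed τ₁ (7.1.14), τ₂ (7.1.15), a_μ (7.1.16), φ_μ (7.1.10) VERBATIM on the right side

statement-level skeleton of published theorems with citation tags; proofs where landed; nothing here is a claim about
the Yang–Mills mass gap

PDF held: `paper:balaban1985-cmp97-bij-higgs-minimizers` (journal page = PDF page + 298).  Read for this file: the renders of
pp. 304–305 [PDF 6–7] in `run/shared/lean/pub/lit-balaban/lit-balaban-r15/pages/` ((2.13)–(2.24)), the text layer of pp. 321–325,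
r15's verbatim transcription of (7.1.2)–(7.1.16) in `BIJ85MomentumSymbols71`, p09's of (4.2.1)–(4.2.2) in `BIJ85SigmaForm421`, and
the verbatim quote of [6I] = [Balaban1984PropagatorsI] (1.61) in `Balaban1983to89.B5Prop11Fiber`.

CITATION HEADER (lean-in-tree rule).  Part of the lit-balaban TYPED SKELETON (HOME `run/shared/lean/pub/lit-balaban/`); WHAT IS
REPRODUCED: the derivation member of SKELETON rows **C1.Eq7.1.13-7.1.19** and **C1.Thm7.1.1** of `HOME/lit-balaban-r15/ROWS-C1.md`
(fold owner r15, referee ref-5) — p. 322 [PDF 24], verbatim: *"The basic object we wish to study is σ_k, defined in (4.2.2),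
σ_k = Q^e_k(I − ∂G_{k,Ax}∂^*)Q^{e*}_k. (7.1.12) The operator G_k was given in the momentum representation in [6I, Eqs. (1.83) and
(1.84)]. Starting from this expression, one can derive the following formulas for σ_k(p) by straightforward, algebraic manipulation:
We express σ_k as a sum of two terms σ_k = τ₁ + τ₂. (7.1.13)"* — r15's named statement `BIJ85MomentumSymbols71.Eq7113` records
*"the derivation from [6 I, (1.83)–(1.84)] is not reproduced"*, p27's `BIJ85Eq712Plancherel` *"NOT CLAIMED: the identification
(7.1.13)"*.  Kind «derivation of a printed formula», at ONE fibre; pure finite-dimensional algebra.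

THE PRINTED INPUTS.  (4.2.1) p. 310: *"exp(−½⟨f, σ_kf⟩) = Z_{k,Ax}^{−1}∫𝒟Aδ(Q_kA)δ_{k,Ax}(A)exp(−½‖∂A − Q^{e*}_kf‖²)"* — a Gaussian
integral over the linear constraint space, so that **⟨f, σ_kf⟩ = min{‖∂A − Q^{e*}_kf‖² : Q_kA = 0, A axial}** and (4.2.2)/(7.1.12)
is the operator form of this minimum (p. 311: *"∂G_{k,Ax}∂^* is a projection operator"*, PROVED abstractly by p09,
`BIJ85SigmaForm421.inner_sigmaOp_eq_norm_sq`); the axial-gauge δ does not change the set of curls {∂A : Q_kA = 0} (a gauge mode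
∂λ changes Q_kA by ∂^{(1)} of the block average of λ, which a block-constant shift of λ removes), and at a fibre it is dropped.  The
block-averaging operators: (2.13) p. 304 *"(QA)_{b′} = L^{−(d+1)} Σ_{x∈B(b′₋)} Σ_{b∈Γ_{xx′}} A_b"*, (2.16) *"(Q^sA)_{b′} =
L^{−(d−1)} Σ_{b∈B^s(b′)} A_b"*, (2.21) p. 305 *"(Q^ef)(p′) = L^{−(d−2)} Σ_{p∈B^e(p′)} f(p)"* (B^e(p′) = the unit plaquettes parallel
to p′ whose bonds touch the four blocks at the corners of p′), (2.19) *"QQ^{s*} = I"*, (2.24) *"Q^e_kQ^{e*}_k = L^{2k}I = η^{−2}I,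
Q^s_kQ^{s*}_k = L^kI = η^{−1}I"*; their momentum symbols: [6I] (1.61) *"(Q_kA)~_μ(p′) = Σ_l u(p′+l)v_μ(p′+l)Ã_μ(p′+l), v_μ(p) =
∂¹_μ(p′)/∂_μ(p)"* (bond weight `rQ` = u·v_μ), and (7.1.11) p. 322 *"(Q^e_kf)~_{μν}(p′) = Σ_l u(p′+l)f̃_{μν}(p′+l)
(v_μ(p′+l)v_ν(p′+l))^{−1}"*; the fine curl (7.1.4) ∂_μ(p′+l) (r15 `dSym`), the unit curl (7.1.5) ∂^{(1)}_μ(p′) (`dOne`); the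
plaquette pairing (2.20) *"⟨f, g⟩ = Σ_p f_pg_p"* (each plaquette once = ½Σ over ordered pairs (μ,ν): `pInner`, `pNormSq`).

WEIGHT CONVENTION NOTE (T-note for the row).  (7.1.11) prints the edge weight u(v_μv_ν)^{−1}.  Under the pairing (7.1.3)
(\bar{f}_{μν} on the left) the printed kernel (7.1.14), *"|u|²/(v̄_μv̄_νv_λv_κ)"*, is the one produced by the edge weight
**w_{μν} = u/(v̄_μv̄_ν)** (`wE`) = (7.1.11)·(v_μv_ν)/(v̄_μv̄_ν) = (7.1.11)·e^{i(1−η)(q_μ+q_ν)}, a unimodular factor = the phase of the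
base point of the edge plaquette inside its block (with r15's `QeSym`, the printed weight, one obtains the complex-conjugate kernel);
with `wE` one also has, termwise, r·s̄ = |u|² for the surface weight s_ν = u/v̄_ν (`sW`, `rQ_mul_conj_sW`; so (2.19) QQ^{s*} = I is
Σ_l|u(p′+l)|² = 1, [6I] p. 23) and the intertwining ∂Q^{s*}_k = Q^{e*}_k∂ used on p. 311 (`qeStar_curlOne`).  This file therefore
works with `wE`; nothing typed by r15 is modified.

WHAT IS TYPED (defs with bodies, §1–§2) at fixed (η, M, p′), shifts l = 2πm, m ∈ r15's `lShifts d M`, q = `shiftMom p′ m`: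
`rQ` (bond weight u·v_ν), `wE` (edge weight), `sW` (surface weight), `curlF` ((∂A)_{μν}(l) = ∂_μ(q)A_ν(l) − ∂_ν(q)A_μ(l)), `qeStar`
(Q^{e*}_kf = w̄·f), `qOp` ((Q_kA)_ν = Σ_l r_ν(l)A_ν(l)), `pInner`/`pNormSq` ((2.20) on ⊕_l Λ²), `energy A f = ‖∂A − Q^{e*}_kf‖²`,
`energySet`, **`sigmaMin f := inf{‖∂A − Q^{e*}_kf‖² : Q_kA = 0}`** (the fibre of (4.2.1)/(7.1.12)); the explicit minimiser:
`coD` (∂^*), `divF` (d^*), `bZero` (B₀ = Δ⁻¹∂^*Q^{e*}f), `remF` (R = (P⊗P)Q^{e*}f, P = r15's bracket [δ − ∂∂̄/Δ] = gen-2 `projK`),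
`xVec` (x = ∂^{(1)}/√φ), `yVec` (y_ν = Σ_μā_μf_{μν}/√φ_ν, gen-2 `hVec`/`scl`), `zVec` (z = P_x y), `cVec` (c = Φ^{−1/2}z), `aOne`
(A₁ = Δ⁻¹Q^*c), `sPar`, `gaugeF`, `minimiser` (A* = B₀ − A₁ − ∂λ); the genericity package `Generic` (∂_μ(q) ≠ 0 ∀l, Δ(q) ≠ 0,
∂^{(1)}_μ ≠ 0, φ_μ > 0, N = Σ|∂^{(1)}_ρ|²/φ_ρ ≠ 0), PROVED at the scales of the model for every p′ with all p′_μ ≠ 0, |p′_μ| ≤ π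
(`generic_scale`, from this seat's closed-cube lemmas).
WHAT IS PROVED in THIS file (zero `sorry`, standard axioms): the algebra of the weights at a generic fibre — v_μ∂_μ = ∂^{(1)}_μ,
r_ν·\bar{∂}_μ·\bar{w}_{μν} = |u/v_μ|²\bar{∂^{(1)}_μ} (`rQ_mul_conj`), r·s̄ = |u|² (`rQ_mul_conj_sW`), ∂Q^{s*}_k = Q^{e*}_k∂ (`qeStar_curlOne`);
**Q_kB₀ = (Σ_μā_μf_{μν})_ν — this is where a_μ (7.1.16) appears, a_μ = (Q^e_k∂Δ⁻¹Q_k^*)_μ** (`qOp_bZero`); **Q_kA₁ = φc — φ_μ (7.1.10)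
is the Gram matrix Q_kΔ⁻¹Q_k^*** (`qOp_aOne`); the constraint Q_kA* = 0 (`qOp_minimiser`, the gauge parameter absorbing the component
along ∂^{(1)}: y − P_xy = s·x, `yVec_sub_zVec`); z ⟂ x, c ⟂ ∂^{(1)} and d^*A₁ = 0 (`divF_aOne`).  The derivation continues in the
siblings `BIJ85Eq7113DerivationPart2` (pointwise Hodge split, normal equations) and `BIJ85Eq7113DerivationPart3` ((7.1.13) as the
minimum = Σ\bar{f}(τ₁ + τ₂)f, and Theorem 7.1.1 for the energies).
NOT CLAIMED: (i) that `rQ`, `wE`, `curlF` ARE the symbols of the configuration-space Q_k, Q^e_k, ∂ of (2.13)/(2.21) on the torus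
(the two-scale Plancherel dictionary — p27's lane, `BIJ85Eq715ConfigSymbols`/`BIJ85Eq719BlockAverageSymbols`, and b2b's [6I]
files), nor the phase convention discussed above; (ii) the fibres with some p′_μ = 0 (the minimum is still defined there; its value
is controlled by continuity in this seat's `BIJ85Thm711ClosedCube`, not re-derived here); (iii) [6I] (1.83)–(1.84) themselves (the
a < ∞ Green's function; (7.1.15)–(7.1.16) are its a → ∞ structure, which is what the δ-function constraint of (4.2.1) produces).
Unit `lit-balaban-p10` (gen 4), HOME as above.
-/

namespace Literature.MathematicalPhysics.QuantumFieldTheory.BalabanImbrieJaffe1984to88.BIJ85Eq7113Derivation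

open scoped BigOperators Real ComplexConjugate Matrix Kronecker
open Complex Finset Matrix
open Literature.MathematicalPhysics.QuantumFieldTheory.BalabanImbrieJaffe1984to88.BIJ85MomentumSymbols71
open Literature.MathematicalPhysics.QuantumFieldTheory.BalabanImbrieJaffe1984to88.BIJ85CurlComplement719
open Literature.MathematicalPhysics.QuantumFieldTheory.BalabanImbrieJaffe1984to88.BIJ85Tau0Positivity729
open Literature.MathematicalPhysics.QuantumFieldTheory.BalabanImbrieJaffe1984to88.BIJ85Tau2Kernel715
open Literature.MathematicalPhysics.QuantumFieldTheory.BalabanImbrieJaffe1984to88.BIJ85SigmaOnCurls325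
open Literature.MathematicalPhysics.QuantumFieldTheory.BalabanImbrieJaffe1984to88.BIJ85Prop712Fibre
open Literature.MathematicalPhysics.QuantumFieldTheory.BalabanImbrieJaffe1984to88.BIJ85Thm711Fibrewise
open Literature.MathematicalPhysics.QuantumFieldTheory.BalabanImbrieJaffe1984to88.BIJ85SigmaClosedCube
open Literature.MathematicalPhysics.QuantumFieldTheory.BalabanImbrieJaffe1984to88.BIJ85Thm711ClosedCube

noncomputable section

variable {d : ℕ}

/-! ## §1 The fibre data of (7.1.12) at a unit momentum p′: bond/edge weights, fine curl, constraint, plaquette norm -/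

section Defs

variable (η : ℝ) (M : ℕ) (p : Fin d → ℝ)

/-- The bond-averaging weight of [6I] (1.61), *"(Q_kA)~_μ(p′) = Σ_l u(p′+l)v_μ(p′+l)Ã_μ(p′+l)"*: r_ν(p′+l) = u(p′+l)v_ν(p′+l)
(r15's `uSym`, `vSym`), the momentum form of (2.13). [cite: BalabanImbrieJaffe1985, (2.13) p.304] -/
def rQ (m : Fin d → ℤ) (ν : Fin d) : ℂ := uSym η (shiftMom p m) * vSym η (shiftMom p m) ν

/-- The edge-averaging weight w_{μν}(p′+l) = u/(v̄_μv̄_ν)(p′+l) of Q^e_k — (7.1.11) up to the unimodular factor (v_μv_ν)/(v̄_μv̄_ν)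
(see the weight convention note in the header). [cite: BalabanImbrieJaffe1985, (7.1.11) p.322] -/
def wE (m : Fin d → ℤ) (μ ν : Fin d) : ℂ :=
  uSym η (shiftMom p m) / (conj (vSym η (shiftMom p m) μ) * conj (vSym η (shiftMom p m) ν))

/-- The surface-averaging weight s_ν(p′+l) = u/v̄_ν(p′+l) of Q^s_k ((2.16)), the one for which r·s̄ = |u|² termwise
((2.19) *"QQ^{s*} = I"* ⟺ Σ_l|u(p′+l)|² = 1) and ∂Q^{s*}_k = Q^{e*}_k∂ (`qeStar_curlOne`). [cite: BalabanImbrieJaffe1985, (2.16) p.304] -/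
def sW (m : Fin d → ℤ) (ν : Fin d) : ℂ := uSym η (shiftMom p m) / conj (vSym η (shiftMom p m) ν)

/-- The fine curl at the shift l: (∂A)_{μν}(p′+l) = ∂_μ(p′+l)A_ν(l) − ∂_ν(p′+l)A_μ(l), ∂_μ of (7.1.4). [cite: BalabanImbrieJaffe1985, (7.1.4) p.322] -/
def curlF (A : (Fin d → ℤ) → Fin d → ℂ) (m : Fin d → ℤ) (μ ν : Fin d) : ℂ :=
  dSym η (shiftMom p m) μ * A m ν - dSym η (shiftMom p m) ν * A m μ

/-- Q^{e*}_kf at the shift l: \bar{w}_{μν}(p′+l)·f_{μν} (the adjoint of the multiplication-and-sum (7.1.11)). [cite: BalabanImbrieJaffe1985, (7.1.11) p.322] -/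
def qeStar (f : Fin d → Fin d → ℂ) (m : Fin d → ℤ) (μ ν : Fin d) : ℂ := conj (wE η p m μ ν) * f μ ν

/-- (Q_kA)_ν(p′) = Σ_l r_ν(p′+l)A_ν(l): the constraint map of δ(Q_kA) in (4.2.1) at the fibre p′ ([6I] (1.61)). [cite: BalabanImbrieJaffe1985, (4.2.1) p.310] -/
def qOp (A : (Fin d → ℤ) → Fin d → ℂ) (ν : Fin d) : ℂ := ∑ m ∈ lShifts d M, rQ η p m ν * A m ν

/-- The plaquette pairing (2.20) *"⟨f, g⟩ = Σ_p f_pg_p"* on ⊕_l Λ²: each plaquette once = ½Σ over ordered (μ,ν), summed over the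
shifts l. [cite: BalabanImbrieJaffe1985, (2.20) p.305] -/
def pInner (F G : (Fin d → ℤ) → Fin d → Fin d → ℂ) : ℂ :=
  (1 / 2 : ℂ) * ∑ m ∈ lShifts d M, ∑ μ, ∑ ν, conj (F m μ ν) * G m μ ν

/-- ‖F‖² for (2.20): ½Σ_lΣ_{μν}|F_{μν}(l)|². [cite: BalabanImbrieJaffe1985, (2.20) p.305] -/
def pNormSq (F : (Fin d → ℤ) → Fin d → Fin d → ℂ) : ℝ :=
  1 / 2 * ∑ m ∈ lShifts d M, ∑ μ, ∑ ν, ‖F m μ ν‖ ^ 2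

/-- The exponent of (4.2.1) at the fibre: ‖∂A − Q^{e*}_kf‖². [cite: BalabanImbrieJaffe1985, (4.2.1) p.310] -/
def energy (A : (Fin d → ℤ) → Fin d → ℂ) (f : Fin d → Fin d → ℂ) : ℝ :=
  pNormSq M fun m μ ν => curlF η p A m μ ν - qeStar η p f m μ ν

/-- The energies of the constrained fields {‖∂A − Q^{e*}_kf‖² : Q_kA = 0} (the support of δ(Q_kA) in (4.2.1); the axial δ does not
change the curls). [cite: BalabanImbrieJaffe1985, (4.2.1) p.310] -/
def energySet (f : Fin d → Fin d → ℂ) : Set ℝ :=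
  {E | ∃ A : (Fin d → ℤ) → Fin d → ℂ, (∀ ν, qOp η M p A ν = 0) ∧ energy η M p A f = E}

/-- **⟨f, σ_k(p′)f⟩ := inf{‖∂A − Q^{e*}_kf‖² : Q_kA = 0}** — the fibre at p′ of (4.2.1), i.e. of (7.1.12)
σ_k = Q^e_k(I − ∂G_{k,Ax}∂^*)Q^{e*}_k (Gaussian integral = minimum of the exponent). [cite: BalabanImbrieJaffe1985, (7.1.12) p.322] -/
def sigmaMin (f : Fin d → Fin d → ℂ) : ℝ := sInf (energySet η M p f)

/-! ## §2 The minimiser -/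

/-- ∂^*F at the shift l: (∂^*F)_ν = Σ_μ \bar{∂}_μ(p′+l)F_{μν}. [cite: BalabanImbrieJaffe1985, (7.1.12) p.322] -/
def coD (F : (Fin d → ℤ) → Fin d → Fin d → ℂ) (m : Fin d → ℤ) (ν : Fin d) : ℂ :=
  ∑ μ, conj (dSym η (shiftMom p m) μ) * F m μ ν

/-- d^*A at the shift l: Σ_μ \bar{∂}_μ(p′+l)A_μ (the divergence). [cite: BalabanImbrieJaffe1985, (7.1.12) p.322] -/
def divF (A : (Fin d → ℤ) → Fin d → ℂ) (m : Fin d → ℤ) : ℂ := ∑ μ, conj (dSym η (shiftMom p m) μ) * A m μ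

/-- B₀ = Δ⁻¹∂^*Q^{e*}_kf (Δ of (7.1.6)): the curl part of the pointwise Hodge split of Q^{e*}_kf. [cite: BalabanImbrieJaffe1985, (7.1.17) p.323] -/
def bZero (f : Fin d → Fin d → ℂ) (m : Fin d → ℤ) (ν : Fin d) : ℂ :=
  (((lapSym η (shiftMom p m))⁻¹ : ℝ) : ℂ) * coD η p (qeStar η p f) m ν

/-- R = (P ⊗ P)Q^{e*}_kf at the shift l, P = [δ − ∂∂̄/Δ] the bracket of (7.1.14) (gen-2 `projK` = r15 `projSym`): the part of
Q^{e*}_kf orthogonal to all curls, (7.1.17) *"τ₁ = Q^e_k(I − P_∂)Q^{e*}_k"*. [cite: BalabanImbrieJaffe1985, (7.1.17) p.323] -/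
def remF (f : Fin d → Fin d → ℂ) (m : Fin d → ℤ) (μ ν : Fin d) : ℂ :=
  ∑ l, ∑ κ, projK (dSym η (shiftMom p m)) μ l * projK (dSym η (shiftMom p m)) ν κ * qeStar η p f m l κ

/-- x = (∂^{(1)}_ν/√φ_ν)_ν, the vector inside the bracket of (7.1.15). [cite: BalabanImbrieJaffe1985, (7.1.15) p.323] -/
def xVec : Fin d → ℂ := scl (phiSym η M p) (dOne p)

/-- y = (Σ_μā_μf_{μν}/√φ_ν)_ν, a = (7.1.16) (gen-2 `hVec`, `scl`). [cite: BalabanImbrieJaffe1985, (7.1.15) p.323] -/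
def yVec (f : Fin d → Fin d → ℂ) : Fin d → ℂ := scl (phiSym η M p) (hVec (aSym η M p) f)

/-- z = P_xy, P_x = [δ_{νκ} − x_νx̄_κ/N] the bracket of (7.1.15) (gen-2 `projK`). [cite: BalabanImbrieJaffe1985, (7.1.15) p.323] -/
def zVec (f : Fin d → Fin d → ℂ) : Fin d → ℂ := projK (xVec η M p) *ᵥ yVec η M p f

/-- c = Φ^{−1/2}z, c_ν = z_ν/√φ_ν (so that c ⟂ ∂^{(1)}). [cite: BalabanImbrieJaffe1985, (7.1.15) p.323] -/
def cVec (f : Fin d → Fin d → ℂ) (ν : Fin d) : ℂ := sqrtInv (phiSym η M p) ν * zVec η M p f ν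

/-- A₁ = Δ⁻¹Q_k^*c: the curl ∂A₁ spans, with c ⟂ ∂^{(1)}, the curls orthogonal to ∂{Q_kA = 0}. [cite: BalabanImbrieJaffe1985, (7.1.15) p.323] -/
def aOne (f : Fin d → Fin d → ℂ) (m : Fin d → ℤ) (ν : Fin d) : ℂ :=
  (((lapSym η (shiftMom p m))⁻¹ : ℝ) : ℂ) * conj (rQ η p m ν) * cVec η M p f ν

/-- s = ⟨x, y⟩/N, N = Σ_ρ|∂^{(1)}_ρ|²/φ_ρ (gen-2 `enn`): the component of y along x. [cite: BalabanImbrieJaffe1985, (7.1.15) p.323] -/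
def sPar (f : Fin d → Fin d → ℂ) : ℂ :=
  (star (xVec η M p) ⬝ᵥ yVec η M p f) / ((enn (dOne p) (phiSym η M p) : ℝ) : ℂ)

/-- The gauge function λ (supported at l = 0, λ(0) = s/u(p′)) restoring Q_kA* = 0. [cite: BalabanImbrieJaffe1985, (4.2.1) p.310] -/
def gaugeF (f : Fin d → Fin d → ℂ) (m : Fin d → ℤ) : ℂ := if m = 0 then sPar η M p f / uSym η p else 0

/-- The minimiser A* = B₀ − A₁ − ∂λ of ‖∂A − Q^{e*}_kf‖² over {Q_kA = 0}. [cite: BalabanImbrieJaffe1985, (4.2.1) p.310] -/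
def minimiser (f : Fin d → Fin d → ℂ) (m : Fin d → ℤ) (ν : Fin d) : ℂ :=
  bZero η p f m ν - aOne η M p f m ν - dSym η (shiftMom p m) ν * gaugeF η M p f m

end Defs

/-! ## §3 Genericity hypotheses -/

/-- The genericity hypotheses at (η, M, p′): no ∂_μ(p′+l) vanishes (so v_μ = ∂^{(1)}_μ/∂_μ is a genuine quotient, Δ(p′+l) ≠ 0),
∂^{(1)}(p′) has no zero component, φ_μ(p′) > 0 and N(p′) ≠ 0 — true at every p′ with all 0 < |p′_μ| ≤ π (`generic_scale`).
[cite: BalabanImbrieJaffe1985, (7.1.8) p.322] -/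
structure Generic (η : ℝ) (M : ℕ) (p : Fin d → ℝ) : Prop where
  /-- no ∂_μ(p′+l) vanishes -/
  dSym_ne : ∀ m ∈ lShifts d M, ∀ μ, dSym η (shiftMom p m) μ ≠ 0
  /-- Δ(p′+l) ≠ 0 -/
  lap_ne : ∀ m ∈ lShifts d M, lapSym η (shiftMom p m) ≠ 0
  /-- ∂^{(1)}_μ(p′) ≠ 0 -/
  dOne_ne : ∀ μ, dOne p μ ≠ 0
  /-- φ_μ(p′) > 0 -/
  phi_pos : ∀ μ, 0 < phiSym η M p μ
  /-- N(p′) = Σ_ρ|∂^{(1)}_ρ|²/φ_ρ ≠ 0 -/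
  enn_ne : enn (dOne p) (phiSym η M p) ≠ 0

section Proofs

variable {η : ℝ} {M : ℕ} {p : Fin d → ℝ}

/-! ### algebra of the weights -/

/-- v_μ(p′+l)∂_μ(p′+l) = ∂^{(1)}_μ(p′) at every shift ((7.1.7)–(7.1.8)). [cite: BalabanImbrieJaffe1985, (7.1.7) p.322] -/
theorem vSym_mul_dSym (hG : Generic η M p) {m : Fin d → ℤ} (hm : m ∈ lShifts d M) (μ : Fin d) :
    vSym η (shiftMom p m) μ * dSym η (shiftMom p m) μ = dOne p μ := by
  rw [vSym_eq, dOne_shiftMom, div_mul_cancel₀ _ (hG.dSym_ne m hm μ)]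

/-- v_μ(p′+l) ≠ 0 at a generic fibre. [cite: BalabanImbrieJaffe1985, (7.1.7) p.322] -/
theorem vSym_ne (hG : Generic η M p) {m : Fin d → ℤ} (hm : m ∈ lShifts d M) (μ : Fin d) :
    vSym η (shiftMom p m) μ ≠ 0 := by
  rw [vSym_eq, dOne_shiftMom]
  exact div_ne_zero (hG.dOne_ne μ) (hG.dSym_ne m hm μ)

/-- u(p′) ≠ 0 at a generic fibre ((7.1.9) u = Πv_μ). [cite: BalabanImbrieJaffe1985, (7.1.9) p.322] -/
theorem uSym_ne (hG : Generic η M p) : uSym η p ≠ 0 := by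
  rw [uSym_eq_prod]
  refine Finset.prod_ne_zero_iff.mpr fun μ _ => ?_
  have h := vSym_ne hG (zero_mem_lShifts d M) μ
  rwa [shiftMom_zero] at h

/-- The product behind (7.1.16): r_ν·\bar{∂}_μ·\bar{w}_{μν} = |u/v_μ|²·\bar{∂^{(1)}_μ} at every shift. [cite: BalabanImbrieJaffe1985, (7.1.16) p.323] -/
theorem rQ_mul_conj (hG : Generic η M p) {m : Fin d → ℤ} (hm : m ∈ lShifts d M) (μ ν : Fin d) :
    rQ η p m ν * conj (dSym η (shiftMom p m) μ) * conj (wE η p m μ ν) =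
      (((‖uSym η (shiftMom p m) / vSym η (shiftMom p m) μ‖ ^ 2 : ℝ)) : ℂ) * conj (dOne p μ) := by
  have hv : ∀ ρ, vSym η (shiftMom p m) ρ ≠ 0 := fun ρ => vSym_ne hG hm ρ
  have hvc : ∀ ρ, conj (vSym η (shiftMom p m) ρ) ≠ 0 := fun ρ => (map_ne_zero _).mpr (hv ρ)
  rw [← vSym_mul_dSym hG hm μ, ← Complex.normSq_eq_norm_sq, ← Complex.mul_conj]
  simp only [rQ, wE, map_mul, map_div₀, Complex.conj_conj]
  field_simp [hv μ, hv ν, hvc μ, hvc ν]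


/-- kernel: z z̄ = |z|² in ℂ. [folklore] -/
private theorem mul_conj_eq (z : ℂ) : z * conj z = ((‖z‖ ^ 2 : ℝ) : ℂ) := by
  rw [Complex.mul_conj, Complex.normSq_eq_norm_sq]

/-- (2.19) termwise: r_ν(p′+l)·\bar{s}_ν(p′+l) = |u(p′+l)|², so that *"QQ^{s*} = I"* at the fibre is Σ_l|u(p′+l)|² = 1
([6I] p. 23). [cite: BalabanImbrieJaffe1985, (2.19) p.305] -/
theorem rQ_mul_conj_sW (hG : Generic η M p) {m : Fin d → ℤ} (hm : m ∈ lShifts d M) (ν : Fin d) :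
    rQ η p m ν * conj (sW η p m ν) = (((‖uSym η (shiftMom p m)‖ ^ 2 : ℝ)) : ℂ) := by
  have hv := vSym_ne hG hm ν
  unfold rQ sW
  rw [map_div₀, Complex.conj_conj, ← mul_conj_eq]
  field_simp

/-- **∂Q^{s*}_k = Q^{e*}_k∂ at the fibre** (the identity used on p. 311, *"we use ∂Q^{s*}_k = Q^{e*}_k∂"*): for every unit one-form B,
Q^{e*}_k(∂^{(1)}B) = ∂(\bar{s}·B) shift by shift, with r15's `curlOne` (*"if f = ∂B"*) — the weight `wE` intertwines exactly.
[cite: BalabanImbrieJaffe1985, (4.3.2) p.311] -/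
theorem qeStar_curlOne (hG : Generic η M p) {m : Fin d → ℤ} (hm : m ∈ lShifts d M) (B : Fin d → ℂ) (μ ν : Fin d) :
    qeStar η p (curlOne p B) m μ ν = curlF η p (fun m ν => conj (sW η p m ν) * B ν) m μ ν := by
  have hvμ := vSym_ne hG hm μ
  have hvν := vSym_ne hG hm ν
  unfold qeStar curlOne curlF wE sW
  rw [← vSym_mul_dSym hG hm μ, ← vSym_mul_dSym hG hm ν]
  simp only [map_mul, map_div₀, Complex.conj_conj]
  field_simp

/-- **Where a_μ (7.1.16) comes from**: (Q_kΔ⁻¹∂^*Q^{e*}_kf)_ν = Σ_μā_μf_{μν}, a_μ = ∂^{(1)}_μΣ_l(|u/v_μ|²/Δ)(p′+l) — r15's `aSym`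
verbatim (*"In the formula for τ₂, the averaging only occurs in a_μ(p′)"*). [cite: BalabanImbrieJaffe1985, (7.1.16) p.323] -/
theorem qOp_bZero (hG : Generic η M p) (f : Fin d → Fin d → ℂ) (ν : Fin d) :
    qOp η M p (bZero η p f) ν = hVec (aSym η M p) f ν := by
  have key : ∀ m ∈ lShifts d M, ∀ μ : Fin d,
      rQ η p m ν * ((((lapSym η (shiftMom p m))⁻¹ : ℝ) : ℂ) *
        (conj (dSym η (shiftMom p m) μ) * (conj (wE η p m μ ν) * f μ ν))) =
      conj (dOne p μ) * ((((‖uSym η (shiftMom p m) / vSym η (shiftMom p m) μ‖ ^ 2 *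
        (lapSym η (shiftMom p m))⁻¹ : ℝ)) : ℂ)) * f μ ν := by
    intro m hm μ
    have h := rQ_mul_conj hG hm μ ν
    push_cast at h ⊢
    linear_combination ((lapSym η (shiftMom p m) : ℂ)⁻¹ * f μ ν) * h
  calc qOp η M p (bZero η p f) ν
      = ∑ m ∈ lShifts d M, ∑ μ, rQ η p m ν * ((((lapSym η (shiftMom p m))⁻¹ : ℝ) : ℂ) *
          (conj (dSym η (shiftMom p m) μ) * (conj (wE η p m μ ν) * f μ ν))) := by
        unfold qOp bZero coD qeStar
        refine Finset.sum_congr rfl fun m _ => ?_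
        rw [Finset.mul_sum, Finset.mul_sum]
    _ = ∑ m ∈ lShifts d M, ∑ μ, conj (dOne p μ) *
          ((((‖uSym η (shiftMom p m) / vSym η (shiftMom p m) μ‖ ^ 2 * (lapSym η (shiftMom p m))⁻¹ : ℝ)) : ℂ)) *
            f μ ν :=
        Finset.sum_congr rfl fun m hm => Finset.sum_congr rfl fun μ _ => key m hm μ
    _ = ∑ μ, ∑ m ∈ lShifts d M, conj (dOne p μ) *
          ((((‖uSym η (shiftMom p m) / vSym η (shiftMom p m) μ‖ ^ 2 * (lapSym η (shiftMom p m))⁻¹ : ℝ)) : ℂ)) *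
            f μ ν := Finset.sum_comm
    _ = hVec (aSym η M p) f ν := by
        unfold hVec aSym
        refine Finset.sum_congr rfl fun μ _ => ?_
        rw [map_mul, map_sum, Finset.mul_sum, Finset.sum_mul]
        refine Finset.sum_congr rfl fun m _ => ?_
        rw [Complex.conj_ofReal]

/-- **Where φ_μ (7.1.10) comes from**: Q_kΔ⁻¹Q_k^* = diag(φ_μ), φ_μ = Σ_l|uv_μ|²Δ^{−1}(p′+l) — r15's `phiSym` verbatim:
(Q_kA₁)_ν = φ_νc_ν. [cite: BalabanImbrieJaffe1985, (7.1.10) p.322] -/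
theorem qOp_aOne (f : Fin d → Fin d → ℂ) (ν : Fin d) :
    qOp η M p (aOne η M p f) ν = (phiSym η M p ν : ℂ) * cVec η M p f ν := by
  unfold qOp aOne
  rw [phiSym]
  push_cast
  rw [Finset.sum_mul]
  refine Finset.sum_congr rfl fun m _ => ?_
  have h : rQ η p m ν * conj (rQ η p m ν) =
      ((‖uSym η (shiftMom p m) * vSym η (shiftMom p m) ν‖ ^ 2 : ℝ) : ℂ) := mul_conj_eq _
  push_cast at h ⊢
  linear_combination ((lapSym η (shiftMom p m) : ℂ)⁻¹ * cVec η M p f ν) * h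

/-- Q_k of a gauge mode: Q_k(∂λ) = ∂^{(1)}·(Σ_lu(p′+l)λ(l)); for the gauge function, = s∂^{(1)}. [cite: BalabanImbrieJaffe1985, (4.2.1) p.310] -/
theorem qOp_gauge (hG : Generic η M p) (f : Fin d → Fin d → ℂ) (ν : Fin d) :
    qOp η M p (fun m ν => dSym η (shiftMom p m) ν * gaugeF η M p f m) ν = dOne p ν * sPar η M p f := by
  have hu := uSym_ne hG
  have hvd := vSym_mul_dSym hG (zero_mem_lShifts d M) ν
  rw [shiftMom_zero] at hvd
  unfold qOp gaugeF
  simp only [mul_ite, mul_zero, Finset.sum_ite_eq', if_pos (zero_mem_lShifts d M)]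
  rw [rQ, shiftMom_zero, ← hvd]
  field_simp

/-- y − P_xy = s·x (the bracket of (7.1.15) removes the x-component). [cite: BalabanImbrieJaffe1985, (7.1.15) p.323] -/
theorem yVec_sub_zVec (hG : Generic η M p) (f : Fin d → Fin d → ℂ) (ν : Fin d) :
    yVec η M p f ν - zVec η M p f ν = sPar η M p f * xVec η M p ν := by
  have hN : (∑ ρ, ‖xVec η M p ρ‖ ^ 2) = enn (dOne p) (phiSym η M p) := sum_norm_scl_sq hG.phi_pos _
  have hN0 : ((enn (dOne p) (phiSym η M p) : ℝ) : ℂ) ≠ 0 := Complex.ofReal_ne_zero.mpr hG.enn_ne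
  unfold zVec sPar
  rw [Matrix.mulVec, dotProduct, dotProduct]
  simp only [projK_apply, hN, sub_mul, Finset.sum_sub_distrib, ite_mul, one_mul, zero_mul, Finset.sum_ite_eq,
    Finset.mem_univ, if_true, Pi.star_apply, Complex.star_def, sub_sub_cancel]
  rw [Finset.sum_div, Finset.sum_mul]
  exact Finset.sum_congr rfl fun j _ => by ring

/-- Q_k is additive. [cite: BalabanImbrieJaffe1985, (2.13) p.304] -/
theorem qOp_sub (A B : (Fin d → ℤ) → Fin d → ℂ) (ν : Fin d) :
    qOp η M p (fun m μ => A m μ - B m μ) ν = qOp η M p A ν - qOp η M p B ν := by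
  unfold qOp
  simp only [mul_sub, Finset.sum_sub_distrib]

/-- The minimiser is constrained: Q_kA* = 0. [cite: BalabanImbrieJaffe1985, (4.2.1) p.310] -/
theorem qOp_minimiser (hG : Generic η M p) (f : Fin d → Fin d → ℂ) (ν : Fin d) :
    qOp η M p (minimiser η M p f) ν = 0 := by
  have hyz := yVec_sub_zVec hG f ν
  have hφ := hG.phi_pos ν
  have hs : (Real.sqrt (phiSym η M p ν) : ℂ) ≠ 0 := Complex.ofReal_ne_zero.mpr (Real.sqrt_pos.mpr hφ).ne'
  have hsq : ((phiSym η M p ν : ℝ) : ℂ) = (Real.sqrt (phiSym η M p ν) : ℂ) * (Real.sqrt (phiSym η M p ν) : ℂ) := by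
    rw [← Complex.ofReal_mul, Real.mul_self_sqrt hφ.le]
  have hy : hVec (aSym η M p) f ν = (Real.sqrt (phiSym η M p ν) : ℂ) * yVec η M p f ν := by
    rw [yVec, scl, sqrtInv]; push_cast; field_simp
  have hx : dOne p ν = (Real.sqrt (phiSym η M p ν) : ℂ) * xVec η M p ν := by
    rw [xVec, scl, sqrtInv]; push_cast; field_simp
  have hc : ((phiSym η M p ν : ℝ) : ℂ) * cVec η M p f ν = (Real.sqrt (phiSym η M p ν) : ℂ) * zVec η M p f ν := by
    rw [cVec, sqrtInv, hsq]; push_cast; field_simp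
  unfold minimiser
  rw [qOp_sub, qOp_sub, qOp_bZero hG, qOp_aOne, qOp_gauge hG, hy, hc, hx]
  linear_combination (Real.sqrt (phiSym η M p ν) : ℂ) * hyz

/-- x ⟂ P_xy. [cite: BalabanImbrieJaffe1985, (7.1.15) p.323] -/
theorem xVec_orth_zVec (hG : Generic η M p) (f : Fin d → Fin d → ℂ) :
    ∑ ν, conj (xVec η M p ν) * zVec η M p f ν = 0 := by
  have hx : (∑ ρ, ‖xVec η M p ρ‖ ^ 2) ≠ 0 := by
    rw [show xVec η M p = scl (phiSym η M p) (dOne p) from rfl, sum_norm_scl_sq hG.phi_pos]; exact hG.enn_ne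
  have h0 : projK (xVec η M p) *ᵥ xVec η M p = 0 := projK_mulVec_self hx
  calc ∑ ν, conj (xVec η M p ν) * zVec η M p f ν
      = star (xVec η M p) ⬝ᵥ (projK (xVec η M p) *ᵥ yVec η M p f) := by
        rw [zVec, dotProduct]; rfl
    _ = star ((projK (xVec η M p))ᴴ *ᵥ xVec η M p) ⬝ᵥ yVec η M p f := by
        rw [Matrix.dotProduct_mulVec, Matrix.star_mulVec, Matrix.conjTranspose_conjTranspose]
    _ = 0 := by rw [projK_conjTranspose, h0, star_zero, zero_dotProduct]

/-- ∂^{(1)} ⟂ c. [cite: BalabanImbrieJaffe1985, (7.1.15) p.323] -/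
theorem dOne_orth_cVec (hG : Generic η M p) (f : Fin d → Fin d → ℂ) :
    ∑ ν, conj (dOne p ν) * cVec η M p f ν = 0 := by
  have hs : ∀ ν, (Real.sqrt (phiSym η M p ν) : ℂ) ≠ 0 := fun ν =>
    Complex.ofReal_ne_zero.mpr (Real.sqrt_pos.mpr (hG.phi_pos ν)).ne'
  have key : ∀ ν, conj (dOne p ν) * cVec η M p f ν = conj (xVec η M p ν) * zVec η M p f ν := by
    intro ν
    have hx : dOne p ν = (Real.sqrt (phiSym η M p ν) : ℂ) * xVec η M p ν := by
      rw [xVec, scl, sqrtInv]; push_cast; field_simp [hs ν]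
    rw [hx, cVec, sqrtInv, map_mul, Complex.conj_ofReal]
    push_cast
    field_simp [hs ν]
  simp_rw [key]
  exact xVec_orth_zVec hG f

/-- d^*A₁ = 0 at every shift (A₁ is co-closed because c ⟂ ∂^{(1)} and r_μ∂_μ = u∂^{(1)}_μ). [cite: BalabanImbrieJaffe1985, (7.1.15) p.323] -/
theorem divF_aOne (hG : Generic η M p) (f : Fin d → Fin d → ℂ) {m : Fin d → ℤ} (hm : m ∈ lShifts d M) :
    divF η p (aOne η M p f) m = 0 := by
  have key : ∀ μ, conj (dSym η (shiftMom p m) μ) *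
      ((((lapSym η (shiftMom p m))⁻¹ : ℝ) : ℂ) * conj (rQ η p m μ) * cVec η M p f μ) =
      (((lapSym η (shiftMom p m))⁻¹ : ℝ) : ℂ) * conj (uSym η (shiftMom p m)) * (conj (dOne p μ) * cVec η M p f μ) := by
    intro μ
    rw [rQ, ← vSym_mul_dSym hG hm μ]
    simp only [map_mul]
    ring
  unfold divF aOne
  simp_rw [key]
  rw [← Finset.mul_sum, dOne_orth_cVec hG f, mul_zero]

end Proofs

end

end Literature.MathematicalPhysics.QuantumFieldTheory.BalabanImbrieJaffe1984to88.BIJ85Eq7113Derivation
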